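import Mathlib
import Summits.MatrixMultiplication.MatrixMultiplication.Theorems.LevelGradedCohnUmansLevelOneGL2DesignsTangencyNormCosets

/-!
# Coset unions of the non-split torus — decidable certificates and records
(stub `stub_tangencySets`, crux `LevelOneGL2Designs`, stmt-MatrixMultiplication-14080; wall-breaker axis 3/12)

Sequel of `…TangencyNormCosets`: `srs_of_normCosets_cert` restates `srs_of_normCosets` with every
hypothesis a CHEAP decidable statement (powers as iterates of "multiply by z" on one vector, generator
test `γ^k e₀ ≠ e₀`, character values supplied as data, private lines tested on their `p` points only),
so that a union of `k` cosets of `μ_m < 𝔽_{p²}^×` of size `k·m` is certified in `O((m·k + p·k)·m)`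
ring operations instead of `(k m)²` pair tests — the only way the records of this seat's coset solver
above `p ≈ 100` can be kernel-checked at all.

Instances are in the sequel `…TangencyNormCosetsRecords` (p = 13: 42 and p = 59: 320 check in 7 s / 58 s); the kernel's
interpretive cost (≈ 1.5 ms per quad multiplication) caps this linear-power certificate near p ≈ 70 — the
binary-powering variant for larger p is `…TangencyNormCosetsBinary`.
-/

set_option linter.dupNamespace false -- `MatrixMultiplication.MatrixMultiplication` (summit = problem, D-0017)

open Finset Matrix

namespace Summit.MatrixMultiplication.MatrixMultiplication.Theorems.LevelOneGL2Designs.FlagLine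

section NormCosetsCert

variable {p : ℕ} [Fact p.Prime]

/-- Iterating "multiply by `z`" is the matrix power of `Q(z)`. [elementary] -/
theorem iterate_quadMul_eq_pow_mulVec (ν : ZMod p) (z v : Fin 2 → ZMod p) (k : ℕ) :
    (fun x : Fin 2 → ZMod p => ![z 0 * x 0 + ν * z 1 * x 1, z 0 * x 1 + z 1 * x 0])^[k] v =
      !![z 0, ν * z 1; z 1, z 0] ^ k *ᵥ v := by
  induction k with
  | zero => simp
  | succ k ih =>
    rw [Function.iterate_succ_apply', ih, pow_succ', ← mulVec_mulVec]
    funext i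
    fin_cases i
    · simp [mulVec, dotProduct, Fin.sum_univ_two]
    · simp [mulVec, dotProduct, Fin.sum_univ_two]; ring

/-- A quad matrix power equals `1` iff it fixes `e₀`. [elementary] -/
theorem quadMat_pow_eq_one_iff (ν : ZMod p) (z : Fin 2 → ZMod p) (k : ℕ) :
    !![z 0, ν * z 1; z 1, z 0] ^ k = 1 ↔ !![z 0, ν * z 1; z 1, z 0] ^ k *ᵥ ![1, 0] = ![1, 0] := by
  constructor
  · intro h; rw [h, one_mulVec]
  · intro h
    obtain ⟨w, hw⟩ := quadMat_pow_isQuad ν z k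
    rw [hw, quadMat_mulVec_e0] at h
    rw [hw, h]
    ext i j; fin_cases i <;> fin_cases j <;> simp

/-- The points of the line `{y | y ⬝ᵥ b = 1}` through `r` with direction `d` (`d ≠ 0`, `d ⬝ᵥ b = 0`,
`r ⬝ᵥ b = 1`) are the `r + t • d`. [elementary] -/
theorem exists_eq_add_smul_of_dotProduct_eq (r d b y : Fin 2 → ZMod p) (hd : d ≠ 0)
    (hdb : d ⬝ᵥ b = 0) (hrb : r ⬝ᵥ b = 1) (hyb : y ⬝ᵥ b = 1) : ∃ t : ZMod p, y = r + t • d := by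
  have hb : b 0 ≠ 0 ∨ b 1 ≠ 0 := by
    by_contra h
    push Not at h
    have : r ⬝ᵥ b = 0 := by simp [dotProduct, Fin.sum_univ_two, h.1, h.2]
    rw [hrb] at this
    exact one_ne_zero this
  have hv : (y - r) ⬝ᵥ b = 0 := by rw [sub_dotProduct, hyb, hrb, sub_self]
  simp only [dotProduct, Fin.sum_univ_two, Pi.sub_apply] at hv hdb
  have hd' : d 0 ≠ 0 ∨ d 1 ≠ 0 := by
    by_contra h
    push Not at h
    apply hd
    funext i; fin_cases i
    · exact h.1
    · exact h.2
  -- case analysis on which coordinate of `b` is non-zero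
  rcases hb with hb0 | hb1
  · -- b 0 ≠ 0: first coordinates are determined by second ones
    have hd1 : d 1 ≠ 0 := by
      intro h0
      rw [h0, zero_mul, add_zero] at hdb
      rcases hd' with h | h
      · exact h ((mul_eq_zero.mp hdb).resolve_right hb0)
      · exact h h0
    refine ⟨(y 1 - r 1) * (d 1)⁻¹, ?_⟩
    funext i
    fin_cases i
    · simp only [Pi.add_apply, Pi.smul_apply, smul_eq_mul, Fin.zero_eta]
      have e1 : d 0 = -(d 1 * b 1) * (b 0)⁻¹ := by
        field_simp
        linear_combination hdb
      have e2 : y 0 - r 0 = -((y 1 - r 1) * b 1) * (b 0)⁻¹ := by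
        field_simp
        linear_combination hv
      have : y 0 = r 0 + (y 0 - r 0) := by ring
      rw [this, e2, e1]
      field_simp
    · simp only [Pi.add_apply, Pi.smul_apply, smul_eq_mul, Fin.mk_one]
      field_simp
      ring
  · have hd0 : d 0 ≠ 0 := by
      intro h0
      rw [h0, zero_mul, zero_add] at hdb
      rcases hd' with h | h
      · exact h h0
      · exact h ((mul_eq_zero.mp hdb).resolve_right hb1)
    refine ⟨(y 0 - r 0) * (d 0)⁻¹, ?_⟩
    funext i
    fin_cases i
    · simp only [Pi.add_apply, Pi.smul_apply, smul_eq_mul, Fin.zero_eta]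
      field_simp
      ring
    · simp only [Pi.add_apply, Pi.smul_apply, smul_eq_mul, Fin.mk_one]
      have e1 : d 1 = -(d 0 * b 0) * (b 1)⁻¹ := by
        field_simp
        linear_combination hdb
      have e2 : y 1 - r 1 = -((y 0 - r 0) * b 0) * (b 1)⁻¹ := by
        field_simp
        linear_combination hv
      have : y 1 = r 1 + (y 1 - r 1) := by ring
      rw [this, e2, e1]
      field_simp

/-- **Coset unions of the non-split torus — decidable-certificate form.**  Same conclusion as
`srs_of_normCosets`, with every hypothesis a CHEAP decidable statement: powers are iterates of
"multiply by `z`" applied to one vector (`O(m)` ring operations), the generator test is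
`γ^k e₀ ≠ e₀` for `0 < k < m`, the character values of the representatives are supplied as
data (`cvals`, checked once), and each private line is tested on its `p` points `r + t•d` only:
total kernel work `O((m·k + p·k)·m)` ring operations for `k` cosets of `μ_m`. [elementary] -/
theorem srs_of_normCosets_cert (ν : ZMod p) (hν : ∀ x y : ZMod p, x * x = ν * (y * y) → x = 0 ∧ y = 0)
    (γ : Fin 2 → ZMod p) (m : ℕ) (hm : 0 < m)
    (hγm : (fun x : Fin 2 → ZMod p => ![γ 0 * x 0 + ν * γ 1 * x 1, γ 0 * x 1 + γ 1 * x 0])^[m]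
      ![1, 0] = ![1, 0])
    (hγk : ∀ k : ℕ, k < m → 0 < k →
      (fun x : Fin 2 → ZMod p => ![γ 0 * x 0 + ν * γ 1 * x 1, γ 0 * x 1 + γ 1 * x 0])^[k]
        ![1, 0] ≠ ![1, 0])
    (reps : List (Fin 2 → ZMod p)) (hreps0 : ∀ r ∈ reps, r ≠ 0)
    (hchars : reps.Pairwise fun r r' =>
      (fun x : Fin 2 → ZMod p => ![r 0 * x 0 + ν * r 1 * x 1, r 0 * x 1 + r 1 * x 0])^[m] ![1, 0] ≠
        (fun x : Fin 2 → ZMod p => ![r' 0 * x 0 + ν * r' 1 * x 1, r' 0 * x 1 + r' 1 * x 0])^[m]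
          ![1, 0])
    (cvals : List (Fin 2 → ZMod p))
    (hcv : reps.map (fun r : Fin 2 → ZMod p =>
      (fun x : Fin 2 → ZMod p => ![r 0 * x 0 + ν * r 1 * x 1, r 0 * x 1 + r 1 * x 0])^[m] ![1, 0]) =
      cvals)
    (ℓ d : (Fin 2 → ZMod p) → (Fin 2 → ZMod p))
    (hℓ : ∀ r ∈ reps, r ⬝ᵥ ℓ r = 1 ∧ d r ≠ 0 ∧ d r ⬝ᵥ ℓ r = 0)
    (hline : ∀ r ∈ reps, ∀ t : ZMod p, t ≠ 0 →
      (fun x : Fin 2 → ZMod p => ![(r + t • d r) 0 * x 0 + ν * (r + t • d r) 1 * x 1,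
        (r + t • d r) 0 * x 1 + (r + t • d r) 1 * x 0])^[m] ![1, 0] ∉ cvals) :
    ∃ S : Finset ((Fin 2 → ZMod p) × (Fin 2 → ZMod p)),
      m * reps.length ≤ S.card ∧ ∀ f ∈ S, ∀ f' ∈ S, (dotProduct f.1 f'.2 = 1 ↔ f = f') := by
  -- character values of the representatives lie in `cvals`
  have hmem : ∀ r' ∈ reps, (fun x : Fin 2 → ZMod p =>
      ![r' 0 * x 0 + ν * r' 1 * x 1, r' 0 * x 1 + r' 1 * x 0])^[m] ![1, 0] ∈ cvals := by
    intro r' hr'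
    rw [← hcv, List.mem_map]
    exact ⟨r', hr', rfl⟩
  -- translate iterates into matrix powers
  simp only [iterate_quadMul_eq_pow_mulVec] at hγm hγk hchars hline hmem
  refine srs_of_normCosets ν hν γ m hm ((quadMat_pow_eq_one_iff ν γ m).mpr hγm)
    (fun k hk hk0 h1 => hγk k hk hk0 ((quadMat_pow_eq_one_iff ν γ k).mp h1)) reps hreps0 hchars ℓ
    (fun r hr => (hℓ r hr).1) ?_
  intro r hr y hyl hne r' hr' heq
  obtain ⟨t, rfl⟩ := exists_eq_add_smul_of_dotProduct_eq r (d r) (ℓ r) y (hℓ r hr).2.1 (hℓ r hr).2.2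
    (hℓ r hr).1 hyl
  have ht : t ≠ 0 := by
    intro h0
    apply hne
    rw [h0, zero_smul, add_zero]
  exact hline r hr t ht (heq ▸ hmem r' hr')


/-- **Coset unions of the non-split torus — first-order certificate** (the form the instances use).
As `srs_of_normCosets_cert`, but the representatives come with their private-line data as a LIST of
frames `(r, ℓ, d)` (point, line normal, line direction), so that every hypothesis is a closed
first-order decidable statement about explicit lists (no function-valued data); powers are linear
iterates (`O(m)` each), adequate for `p ≲ 100`. [elementary] -/
theorem srs_of_normCosets_cert4 (ν : ZMod p) (hν : ∀ x y : ZMod p, x * x = ν * (y * y) → x = 0 ∧ y = 0)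
    (γ : Fin 2 → ZMod p) (m : ℕ) (hm : 0 < m)
    (hγm : (fun x : Fin 2 → ZMod p => ![γ 0 * x 0 + ν * γ 1 * x 1, γ 0 * x 1 + γ 1 * x 0])^[m]
        ![1, 0] = ![1, 0])
    (hγk : ∀ k : ℕ, k < m → 0 < k →
      (fun x : Fin 2 → ZMod p => ![γ 0 * x 0 + ν * γ 1 * x 1, γ 0 * x 1 + γ 1 * x 0])^[k]
        ![1, 0] ≠ ![1, 0])
    (frames : List ((Fin 2 → ZMod p) × (Fin 2 → ZMod p) × (Fin 2 → ZMod p)))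
    (hreps0 : ∀ f ∈ frames, f.1 ≠ 0)
    (cvals : List (Fin 2 → ZMod p)) (hcvn : cvals.Nodup)
    (hcv : frames.map (fun f =>
      (fun x : Fin 2 → ZMod p => ![f.1 0 * x 0 + ν * f.1 1 * x 1, f.1 0 * x 1 + f.1 1 * x 0])^[m]
        ![1, 0]) = cvals)
    (hℓ : ∀ f ∈ frames, f.1 ⬝ᵥ f.2.1 = 1 ∧ f.2.2 ≠ 0 ∧ f.2.2 ⬝ᵥ f.2.1 = 0)
    (hline : ∀ f ∈ frames, ∀ t : ZMod p, t ≠ 0 →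
      (fun x : Fin 2 → ZMod p => ![(f.1 + t • f.2.2) 0 * x 0 + ν * (f.1 + t • f.2.2) 1 * x 1,
        (f.1 + t • f.2.2) 0 * x 1 + (f.1 + t • f.2.2) 1 * x 0])^[m] ![1, 0] ∉ cvals) :
    ∃ S : Finset ((Fin 2 → ZMod p) × (Fin 2 → ZMod p)),
      m * frames.length ≤ S.card ∧ ∀ f ∈ S, ∀ f' ∈ S, (dotProduct f.1 f'.2 = 1 ↔ f = f') := by
  classical
  -- translate iterates into matrix powers
  simp only [iterate_quadMul_eq_pow_mulVec] at hγm hγk hcv hline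
  set G : Matrix (Fin 2) (Fin 2) (ZMod p) := !![γ 0, ν * γ 1; γ 1, γ 0] with hG
  have hGm : G ^ m = 1 := (quadMat_pow_eq_one_iff ν γ m).mpr hγm
  have hγk' : ∀ k : ℕ, k < m → 0 < k → G ^ k ≠ 1 := fun k hk hk0 h1 =>
    hγk k hk hk0 ((quadMat_pow_eq_one_iff ν γ k).mp h1)
  -- representatives, lines, directions as functions
  let reps : List (Fin 2 → ZMod p) := frames.map Prod.fst
  have hfr : ∀ r ∈ reps, ∃ f ∈ frames, f.1 = r := fun r hr => List.mem_map.mp hr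
  choose! fr hfr1 hfr2 using hfr
  let ℓ : (Fin 2 → ZMod p) → (Fin 2 → ZMod p) := fun r => (fr r).2.1
  let d : (Fin 2 → ZMod p) → (Fin 2 → ZMod p) := fun r => (fr r).2.2
  have hrepslen : reps.length = frames.length := List.length_map _
  have hreps0' : ∀ r ∈ reps, r ≠ 0 := by
    intro r hr; rw [← hfr2 r hr]; exact hreps0 _ (hfr1 r hr)
  -- characters of representatives
  have hmem : ∀ r' ∈ reps, !![r' 0, ν * r' 1; r' 1, r' 0] ^ m *ᵥ ![1, 0] ∈ cvals := by
    intro r' hr'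
    obtain ⟨f, hf, rfl⟩ := List.mem_map.mp hr'
    rw [← hcv, List.mem_map]
    exact ⟨f, hf, rfl⟩
  have hchars : reps.Pairwise fun r r' =>
      !![r 0, ν * r 1; r 1, r 0] ^ m *ᵥ ![1, 0] ≠ !![r' 0, ν * r' 1; r' 1, r' 0] ^ m *ᵥ ![1, 0] := by
    have hnd : (frames.map fun f => !![f.1 0, ν * f.1 1; f.1 1, f.1 0] ^ m *ᵥ ![1, 0]).Nodup := by
      rw [hcv]; exact hcvn
    have e : (frames.map fun f => !![f.1 0, ν * f.1 1; f.1 1, f.1 0] ^ m *ᵥ ![1, 0]) =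
        reps.map fun r : Fin 2 → ZMod p => !![r 0, ν * r 1; r 1, r 0] ^ m *ᵥ ![1, 0] := by
      simp [reps, List.map_map, Function.comp_def]
    rw [e, List.Nodup, List.pairwise_map] at hnd
    exact hnd
  obtain ⟨S, hS, hsrs⟩ := srs_of_normCosets ν hν γ m hm hGm hγk' reps hreps0' hchars ℓ
    (fun r hr => by have h1 := (hℓ _ (hfr1 r hr)).1; rwa [hfr2 r hr] at h1) (by
      intro r hr y hyl hne r' hr' heq
      have hf := hfr1 r hr
      have hℓf := hℓ _ hf
      rw [hfr2 r hr] at hℓf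
      obtain ⟨t, rfl⟩ := exists_eq_add_smul_of_dotProduct_eq r (d r) (ℓ r) y hℓf.2.1 hℓf.2.2 hℓf.1 hyl
      have ht : t ≠ 0 := by
        intro h0
        apply hne
        rw [h0, zero_smul, add_zero]
      have hl := hline _ hf t ht
      rw [hfr2 r hr] at hl
      exact hl (heq ▸ hmem r' hr'))
  exact ⟨S, hrepslen ▸ hS, hsrs⟩

end NormCosetsCert

end Summit.MatrixMultiplication.MatrixMultiplication.Theorems.LevelOneGL2Designs.FlagLine
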